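import Mathlib

/-!
# SoloBlindSignCharacters — orthogonality of sign characters and vanishing of traces

Solo seat `solo-Langlands-blind` (blind mode), session 7.  Elementary algebra: the functions
`e ↦ ∏_{k ∈ B} e_k` on the group of sign vectors `e : ι → ℤˣ` (`ι` finite), viewed in a field `K`
with `2 ≠ 0`, are pairwise orthogonal (`∑_e ∏_{k ∈ B} e_k = 0` for `B ≠ ∅`), hence: if
`∑_i T_i ∏_{k ∈ A_i} e_k = ∑_i t_i e_i` for EVERY sign vector `e` and no `A_i` is a singleton, then
every `t_i` vanishes.

This is the combinatorial heart of the uniform twist-compatibility argument of this seat's dihedral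
descent for an arbitrary odd degree `g` (paper/dihedral-descent.md §5.11, Proposition 5.3.1_g):
there `ι = ℤ/g` indexes the conjugates of the phantom representation `R'` at a prime split
completely in the Galois closure, `A_i = {i} ∪ (i + I)` for a symmetric set `I ⊆ (ℤ/g) ∖ {0}` of
"bad" twist indices (so `|A_i| = |I| + 1 ≥ 3` when `I ≠ ∅`), every sign vector is realised by a
quadratic Hecke character, `T_i` are Frobenius traces of the conjugates of `R'` and `t_i` Hecke
traces; the conclusion `t_i = 0` at all degree-one places contradicts the Rankin–Selberg pole,
so `I = ∅`.  No number theory is used here.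

* `sum_signVector_prod_eq_zero`: `∑_{e : ι → ℤˣ} ∏_{k ∈ B} e_k = 0` for `B` nonempty.
* `eq_zero_of_sign_identities`: the vanishing of the `t_i`.
-/

namespace Summit.Langlands.Langlands.Theorems
namespace SoloBlind

open Finset

section SignCharacters

variable {K : Type*} [Field K]
variable {ι : Type*} [Fintype ι] [DecidableEq ι]

/-- A sign `x ∈ ℤˣ`, viewed in `K`, squares to one. -/
theorem unitsInt_cast_mul_self (x : ℤˣ) : ((x : ℤ) : K) * ((x : ℤ) : K) = 1 := by
  rcases Int.units_eq_one_or x with rfl | rfl <;> simp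

/-- The two signs sum to zero in `K`. -/
theorem sum_unitsInt_cast : ∑ x : ℤˣ, ((x : ℤ) : K) = 0 := by
  rw [UnitsInt.univ, Finset.sum_pair (by decide : (1 : ℤˣ) ≠ -1)]
  simp

/-- **Orthogonality of sign characters**: `∑_{e : ι → ℤˣ} ∏_{k ∈ B} e_k = 0` for `B ≠ ∅`. -/
theorem sum_signVector_prod_eq_zero {B : Finset ι} (hB : B.Nonempty) :
    ∑ e : ι → ℤˣ, ∏ k ∈ B, ((e k : ℤ) : K) = 0 := by
  have hrw : ∀ e : ι → ℤˣ,
      ∏ k ∈ B, ((e k : ℤ) : K) = ∏ k, (if k ∈ B then ((e k : ℤ) : K) else 1) := by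
    intro e
    rw [Finset.prod_ite_mem, Finset.univ_inter]
  simp_rw [hrw]
  rw [← Fintype.prod_sum (fun k (x : ℤˣ) => if k ∈ B then ((x : ℤ) : K) else 1)]
  obtain ⟨k, hk⟩ := hB
  apply Finset.prod_eq_zero (Finset.mem_univ k)
  simp only [hk, if_true]
  exact sum_unitsInt_cast

omit [Fintype ι] in
/-- Multiplying a sign character by one more sign gives the character of the flipped set. -/
theorem sign_mul_prod (e : ι → ℤˣ) (B : Finset ι) (j : ι) :
    ((e j : ℤ) : K) * ∏ k ∈ B, ((e k : ℤ) : K)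
      = ∏ k ∈ (if j ∈ B then B.erase j else insert j B), ((e k : ℤ) : K) := by
  split_ifs with hj
  · rw [← Finset.mul_prod_erase B (fun k => ((e k : ℤ) : K)) hj, ← mul_assoc,
      unitsInt_cast_mul_self, one_mul]
  · rw [Finset.prod_insert hj]

omit [Fintype ι] in
/-- The flipped set is nonempty unless `B = {j}`. -/
theorem flip_nonempty {B : Finset ι} {j : ι} (hB : B ≠ {j}) :
    (if j ∈ B then B.erase j else insert j B).Nonempty := by
  split_ifs with hj
  · rw [Finset.nonempty_iff_ne_empty]
    intro h
    apply hB
    ext k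
    rw [Finset.mem_singleton]
    constructor
    · intro hk
      by_contra hkj
      have hk' : k ∈ B.erase j := Finset.mem_erase.mpr ⟨hkj, hk⟩
      rw [h] at hk'
      simp at hk'
    · rintro rfl
      exact hj
  · exact Finset.insert_nonempty j B

/-- The number of sign vectors, in `K`, is a power of two, hence non-zero when `2 ≠ 0`. -/
theorem sum_signVector_one (h2 : (2 : K) ≠ 0) :
    (∑ _e : ι → ℤˣ, (1 : K)) = 2 ^ Fintype.card ι ∧ (2 : K) ^ Fintype.card ι ≠ 0 := by
  refine ⟨?_, pow_ne_zero _ h2⟩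
  rw [Finset.sum_const, Finset.card_univ, Fintype.card_fun, Fintype.card_units_int]
  simp

/-- **Vanishing of traces.** If `∑_i T_i ∏_{k ∈ A_i} e_k = ∑_i t_i e_i` for every sign vector
`e : ι → ℤˣ` and no `A_i` is a singleton, then `t_j = 0` for every `j` (over a field with `2 ≠ 0`).
Proof: multiply by `e_j` and sum over all `e`; by orthogonality the left side vanishes termwise and
the right side is `2^{|ι|} t_j`. -/
theorem eq_zero_of_sign_identities (h2 : (2 : K) ≠ 0) (A : ι → Finset ι)
    (hA : ∀ i j, A i ≠ {j}) (T t : ι → K)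
    (h : ∀ e : ι → ℤˣ,
      ∑ i, T i * ∏ k ∈ A i, ((e k : ℤ) : K) = ∑ i, t i * ((e i : ℤ) : K)) :
    ∀ j, t j = 0 := by
  intro j
  -- sum the identity against the sign `e_j`
  have key : ∑ e : ι → ℤˣ, ((e j : ℤ) : K) * ∑ i, T i * ∏ k ∈ A i, ((e k : ℤ) : K)
      = ∑ e : ι → ℤˣ, ((e j : ℤ) : K) * ∑ i, t i * ((e i : ℤ) : K) := by
    refine Finset.sum_congr rfl fun e _ => ?_
    rw [h e]
  -- left side: zero
  have lhs : ∑ e : ι → ℤˣ, ((e j : ℤ) : K) * ∑ i, T i * ∏ k ∈ A i, ((e k : ℤ) : K) = 0 := by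
    have step : ∀ e : ι → ℤˣ, ((e j : ℤ) : K) * ∑ i, T i * ∏ k ∈ A i, ((e k : ℤ) : K)
        = ∑ i, T i * ∏ k ∈ (if j ∈ A i then (A i).erase j else insert j (A i)),
            ((e k : ℤ) : K) := by
      intro e
      rw [Finset.mul_sum]
      refine Finset.sum_congr rfl fun i _ => ?_
      rw [← sign_mul_prod e (A i) j]
      ring
    simp_rw [step]
    rw [Finset.sum_comm]
    refine Finset.sum_eq_zero fun i _ => ?_
    rw [← Finset.mul_sum, sum_signVector_prod_eq_zero (flip_nonempty (hA i j)), mul_zero]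
  -- right side: 2^|ι| * t j
  have rhs : ∑ e : ι → ℤˣ, ((e j : ℤ) : K) * ∑ i, t i * ((e i : ℤ) : K)
      = (2 : K) ^ Fintype.card ι * t j := by
    have step : ∀ e : ι → ℤˣ, ((e j : ℤ) : K) * ∑ i, t i * ((e i : ℤ) : K)
        = ∑ i, t i * ∏ k ∈ (if j ∈ ({i} : Finset ι) then ({i} : Finset ι).erase j
            else insert j {i}), ((e k : ℤ) : K) := by
      intro e
      rw [Finset.mul_sum]
      refine Finset.sum_congr rfl fun i _ => ?_
      rw [← sign_mul_prod e {i} j, Finset.prod_singleton]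
      ring
    simp_rw [step]
    rw [Finset.sum_comm, ← Finset.sum_erase_add _ _ (Finset.mem_univ j)]
    have off : ∑ i ∈ univ.erase j, ∑ e : ι → ℤˣ, t i *
        ∏ k ∈ (if j ∈ ({i} : Finset ι) then ({i} : Finset ι).erase j else insert j {i}),
          ((e k : ℤ) : K) = 0 := by
      refine Finset.sum_eq_zero fun i hi => ?_
      have hij : i ≠ j := Finset.ne_of_mem_erase hi
      have hne : ({i} : Finset ι) ≠ {j} := by
        intro hs
        exact hij (Finset.singleton_injective hs)
      rw [← Finset.mul_sum, sum_signVector_prod_eq_zero (flip_nonempty hne), mul_zero]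
    have diag : ∑ e : ι → ℤˣ, t j *
        ∏ k ∈ (if j ∈ ({j} : Finset ι) then ({j} : Finset ι).erase j else insert j {j}),
          ((e k : ℤ) : K) = (2 : K) ^ Fintype.card ι * t j := by
      simp only [Finset.mem_singleton, if_true, Finset.erase_singleton, Finset.prod_empty,
        mul_one]
      rw [Finset.sum_const, Finset.card_univ, Fintype.card_fun, Fintype.card_units_int]
      simp [mul_comm]
    rw [off, diag, zero_add]
  rw [lhs, rhs] at key
  exact (mul_eq_zero.mp key.symm).resolve_left (pow_ne_zero _ h2)

end SignCharacters

end SoloBlind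
end Summit.Langlands.Langlands.Theorems
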